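import Summits.QuantumFields.BalabanUV.Beta.FP.LetterInheritance
import Summits.QuantumFields.BalabanUV.Beta.KernelWardRelative

/-!
# `BalabanUV.Beta.FP.LetterInheritanceEnd` — road «FP» for binder row D1, sub-row N3-fine-LETTERS-END («D1-FP-HH-INHERIT», owner d1-p3-g3 GO
# «in generic shape», journal l.16343): the ℋ-column Ward letter (H) passes to entrywise limits, an1's COARSE Ward END restated for an
# ARBITRARY triple `(K, S, W)` of the generic shape `hessKer K (vertexOfK K N S) W` from the FOUR COARSE LETTERS (K)(H)(S)(W), and the same
# END for a LIMIT triple `(K∞, S∞, W∞)` with the four letters INHERITED from ANY supplied finite-`j` family (`FP/LetterInheritance`)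

HONEST DEPENDENCY (page 1, mandatory): continuum YM on T⁴ ⇐ BetaPertH ∧ nine spine estimates (0/9 proved); BetaPertH ⇐ (D1) ∧ (D4) ∧
CAP+tail; G-an2-4 gates asym, D1 and NE2/3/4.  HONEST FRAMING (cell contract, verbatim): «discharging `BetaPertH` makes Bałaban's UV
stability UNCONDITIONAL — a real constructive-QFT result; it is NOT the continuum limit and NOT the Clay problem.»  [folklore] bookkeeping:
limits of FINITE sums of kernel entries + an1's `KernelWardRelative.wardTransversal_flipK_hessKer_conj_rel` BY NAME + leaf-01-g5's
`FP/LetterInheritance` BY NAME + `HessKerRate.vertexFamily_vertexOfK_rate` BY NAME.  No definition, no `def … : Prop`, nothing cited, 0 sorry;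
every rate ∕ bound ∕ letter is a HYPOTHESIS; NO perfect object of road FP (`KPerf`, `SPerfOf`, `TPerfOf`) and NO dressing (`axDressK`,
`coDressKBmAt`) is named — road FP instantiates (owner d1-p3-g3, `FP/RoadEndGeneric` ∕ R-FP-13).  0∕4 binders of row D1; NOT the letters,
NOT hW, NOT hrep, NOT D1, NOT BetaPertH, NOT continuum, NOT Clay.  ABSOLUTE RULE (cell charter, verbatim): «No internally-minted statement
may enter as a cited fact. Every hypothesis is either kernel-proved in this package or a verbatim quotation of a PUBLISHED theorem with page
reference. The manuscript(s) under audit are NOT citable for their own disputed steps — they are the thing under adjudication;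
programme-internal (2001/route/tribunal) claims are never citable.»

WHY.  Road FP's END of record (`FP/RoadWardExplicit`) still carries `hWj : ∀ j, WardTransversal (flipK (TbalOf …))`; the owner's question
«STEP-NO-HW?» (l.15895) is answered by feeding an1's COARSE END `KernelWardRelative.wardTransversal_flipK_hessKer_conj_rel` at the perfect triple
(leaf-01-g5 ADDENDUM l.15931, leaf-02-g5 «D1-FP-STEP-NO-HW» l.16207).  That END wants, for a kernel triple `hessKer K (vertexOfK K N S) W`, four
COARSE LETTERS: (K) `RelInv K 𝕄 E`; (H) `Σ_μ (colH K N μ (y − e_μ) κ′ u − colH K N μ y κ′ u) = c_H · gaugeWt N y κ′ u`; (S)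
`c_H • Σ_{v∈box} divV S (N•y + v) = conjV 𝕄 (X y)`; (W) `divW W y ν y′ = conjW 𝕄 0 (vertexOfK K N S ν y′) (X y) 0 (X₂ y ν y′) + N y ν y′` with
`tadpole K (N …) = 0`.  `FP/LetterInheritance` passes (K), (S), (W) from finite `j` to entrywise limits; THIS FILE adds (H) (one kernel entry per
term: `colH K N μ y κ′ u = K u (N•y) (inl κ′) (inr μ)`), the covariance ∕ commutation sockets, and assembles the END at a limit triple.

CONTENT (all [folklore]; dimension `d + 1`, packed fibre `Fib d`, blocking `N`).
* §1 (H) AND THE SOCKETS PASS TO ENTRYWISE LIMITS: **`hH_of_tendsto`**; `hH_scaleK` (the (H) letter under the cell's diagonal change of units,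
  constant `s_f·s_m·c_H`); `shiftK_eq_of_tendsto` (block-translation invariance of `K∞`), `stencil_translate_of_tendsto` ((St♭) of `S∞`),
  `table_translate_of_tendsto` ((Wt) of `W∞`), `comm_of_rate` (`comp E (X j) = comp (X j) E ∀ j ⟹ comp E X∞ = comp X∞ E`).
* §2 **`wardTransversal_flipK_hessKer_vertexOfK_of_letters`**: an ARBITRARY triple `(K, S, W)` — raw families with `LocStencil S Cs δ`,
  `VertexFamily₂ W N Cw δ` (the `JetData` record is assembled inside; no wall family, no `TPerfOf`, no dressing) — and the four coarse letters
  ⟹ `WardTransversal (flipK (hessKer K (vertexOfK K N S) W))` (= an1's END BY NAME).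
* §3 currency adapters (`decays_of_biLoc_diag`, `decays_vertexOfK_apply`, `decays_vertexOfK_rate_apply`, `tendsto_divW_of_rate`, …) and
  **`wardTransversal_flipK_hessKer_vertexOfK_of_inherited_letters`**: for a LIMIT triple `(K∞, S∞, W∞)` of ANY supplied family
  `(K j, 𝕄 j, E, S j, W j, X j, X₂ j, N j, c_H j)` carrying the four letters AT EVERY `j`, with rate data in the cell's currencies (`Decays (K j − K∞)
  (cK·θ^j) δ`, `LocStencil (S j − S∞) (cS·θ^j) δ`, `VertexFamily₂ (W j − W∞) N (cW·θ^j) δ`, `Decays`-rate for `𝕄`, `BiLoc`-rates for `X`, `X₂`, `N`,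
  `c_H j → c_H∞`, `0 ≤ θ < 1`) and the limit triple's block covariances ⟹ `WardTransversal (flipK (hessKer K∞ (vertexOfK K∞ N S∞) W∞))` — letters
  inherited by `relInv_of_rate` (K), `hH_of_tendsto` (H), `blockWard_of_rate` (S), `law_conjW_of_rate` + `tadpoleNull_of_rate` (W), vertex rate
  `HessKerRate.vertexFamily_vertexOfK_rate`, then §2.
NOT HERE: any rate datum, any letter at finite `j` (tree theorems of the an1 ∕ an2 ∕ an3 ∕ leaf-10 lineages for their families), any perfect object.
Unit `b2b-balaban-beta-d1-formalise-leaf-01` (gen 6), 2026-08-20; claim table `HOME/b2b-balaban-beta-d1-p3/LEAVES-FP.md` (N3-fine-LETTERS-END).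
-/

noncomputable section
namespace Summit.QuantumFields.BalabanUV.Beta.FP.LetterInheritanceEnd
open Finset Filter Topology
open scoped BigOperators
open Literature.MathematicalPhysics.QuantumFieldTheory Literature.MathematicalPhysics.QuantumFieldTheory.Balaban1983to89
open Literature.MathematicalPhysics.QuantumFieldTheory.Balaban1983to89.Beta
open B12Sec2to5 (l1 l1_nonneg)
open B6BondElimination (unitVec)
open ExpKernelCalculus (MKer Decays BiLoc comp tr tadpole hessKer VertexFamily VertexFamily₂ shiftK Zl)
open PolarizationSign (WardTransversal)
open KernelWard (divV divW)
open AffineAveraging (box toSite)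
open OneStepResolventKernel (Fib wsum LocStencil JetData)
open OneStepKernelFamily (colH vertexOfK flipK)
open HessKerRate (scaleK scaleK_apply vertexFamily_vertexOfK_rate vertexFamily_vertexOfK_uniform decays_zero biLoc_zero)
open HessKerDressedLimit (tendsto_of_decays_rate tendsto_of_biLoc_rate mker_sub_apply)
open Summit.QuantumFields.BalabanUV.Beta.TameKernelCalculus (Loc Spr)
open Summit.QuantumFields.BalabanUV.Beta.ChartConjugation (conjV conjW)
open Summit.QuantumFields.BalabanUV.Beta.ChartConjugationRelative (RelInv)
open Summit.QuantumFields.BalabanUV.Beta.KernelWardRelative (gaugeWt wardTransversal_flipK_hessKer_conj_rel)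
open Summit.QuantumFields.BalabanUV.Beta.FP.LetterInheritance

variable {d N : ℕ}

/-! ## §1 The ℋ-column Ward letter (H) and the covariance ∕ commutation sockets pass to entrywise limits -/
section H
/-- [folklore] **THE ℋ-COLUMN WARD LETTER (H) PASSES TO ENTRYWISE LIMITS.**  Each term `colH K N μ y κ′ u = K u (N•y) (inl κ′) (inr μ)` is ONE
kernel entry, the sum over `μ` is finite: `K j → K∞` entrywise and `c_H j → c_H∞` carry the letter to the limit. -/
theorem hH_of_tendsto {K : ℕ → MKer (d + 1) (Fib d)} {Kinf : MKer (d + 1) (Fib d)}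
    (hK : ∀ x z a b, Tendsto (fun j => K j x z a b) atTop (𝓝 (Kinf x z a b))) {cH : ℕ → ℝ} {cHinf : ℝ}
    (hc : Tendsto cH atTop (𝓝 cHinf))
    (hH : ∀ (j : ℕ) (y : Fin (d + 1) → ℤ) (κ' : Fin (d + 1)) (u : Fin (d + 1) → ℤ),
      ∑ μ, (colH (K j) N μ (y - unitVec μ) κ' u - colH (K j) N μ y κ' u) = cH j * gaugeWt N y κ' u)
    (y : Fin (d + 1) → ℤ) (κ' : Fin (d + 1)) (u : Fin (d + 1) → ℤ) :
    ∑ μ, (colH Kinf N μ (y - unitVec μ) κ' u - colH Kinf N μ y κ' u) = cHinf * gaugeWt N y κ' u := by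
  have hL : Tendsto (fun j => ∑ μ, (colH (K j) N μ (y - unitVec μ) κ' u - colH (K j) N μ y κ' u)) atTop
      (𝓝 (∑ μ, (colH Kinf N μ (y - unitVec μ) κ' u - colH Kinf N μ y κ' u))) := by
    refine tendsto_finsetSum _ fun μ _ => ?_
    simp only [colH]
    exact (hK _ _ _ _).sub (hK _ _ _ _)
  have hR : Tendsto (fun j => cH j * gaugeWt N y κ' u) atTop (𝓝 (cHinf * gaugeWt N y κ' u)) := hc.mul_const _
  exact tendsto_nhds_unique (by simpa only [hH] using hL) hR

/-- [folklore] **THE (H) LETTER UNDER THE DIAGONAL CHANGE OF UNITS** `K ↦ scaleK u u K` with `u` constant `s_f` on field legs and `s_m` on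
multiplier legs (the cell's `HessKerDressedUnits.unitK s_f s_m = scaleK (legScale s_f s_m) (legScale s_f s_m)`): constant `s_f·s_m·c_H`. -/
theorem hH_scaleK {K : MKer (d + 1) (Fib d)} (u : Fib d → ℝ) {sf sm : ℝ} (huf : ∀ κ : Fin (d + 1), u (Sum.inl κ) = sf)
    (hum : ∀ μ : Fin (d + 1), u (Sum.inr μ) = sm) {cH : ℝ}
    (hH : ∀ (y : Fin (d + 1) → ℤ) (κ' : Fin (d + 1)) (v : Fin (d + 1) → ℤ),
      ∑ μ, (colH K N μ (y - unitVec μ) κ' v - colH K N μ y κ' v) = cH * gaugeWt N y κ' v)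
    (y : Fin (d + 1) → ℤ) (κ' : Fin (d + 1)) (v : Fin (d + 1) → ℤ) :
    ∑ μ, (colH (scaleK u u K) N μ (y - unitVec μ) κ' v - colH (scaleK u u K) N μ y κ' v) = (sf * sm * cH) * gaugeWt N y κ' v := by
  have e : ∀ μ : Fin (d + 1), colH (scaleK u u K) N μ (y - unitVec μ) κ' v - colH (scaleK u u K) N μ y κ' v
      = (sf * sm) * (colH K N μ (y - unitVec μ) κ' v - colH K N μ y κ' v) := fun μ => by
    simp only [colH, scaleK_apply, huf, hum]; ring
  rw [Finset.sum_congr rfl fun μ _ => e μ, ← Finset.mul_sum, hH y κ' v]; ring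

/-- [folklore] **BLOCK-TRANSLATION INVARIANCE PASSES TO ENTRYWISE LIMITS**: `shiftK t (K j) = K j ∀ j`, `K j → K∞` ⟹ `shiftK t K∞ = K∞`. -/
theorem shiftK_eq_of_tendsto {D : ℕ} {F : Type*} {K : ℕ → MKer D F} {Kinf : MKer D F}
    (hK : ∀ x z a b, Tendsto (fun j => K j x z a b) atTop (𝓝 (Kinf x z a b))) (t : Fin D → ℤ)
    (hs : ∀ j, shiftK t (K j) = K j) : shiftK t Kinf = Kinf := by
  funext x z a b
  have h1 : Tendsto (fun j => K j (x + t) (z + t) a b) atTop (𝓝 (Kinf (x + t) (z + t) a b)) := hK _ _ _ _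
  have h2 : Tendsto (fun j => K j (x + t) (z + t) a b) atTop (𝓝 (Kinf x z a b)) := by
    have e : ∀ j, K j (x + t) (z + t) a b = K j x z a b := fun j => by
      have := congrArg (fun L : MKer D F => L x z a b) (hs j); simpa only [shiftK] using this
    simp only [e]; exact hK x z a b
  exact tendsto_nhds_unique h1 h2

/-- [folklore] **(St♭) PASSES TO ENTRYWISE LIMITS**: `S j κ′ (u + N•t) = shiftK (−N•t) (S j κ′ u) ∀ j` ⟹ the same for `S∞`. -/
theorem stencil_translate_of_tendsto {D : ℕ} {F : Type*} {S : ℕ → Fin D → (Fin D → ℤ) → MKer D F}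
    {Sinf : Fin D → (Fin D → ℤ) → MKer D F}
    (hS : ∀ κ u x z a b, Tendsto (fun j => S j κ u x z a b) atTop (𝓝 (Sinf κ u x z a b)))
    (hSt : ∀ (j : ℕ) (κ' : Fin D) (u t : Fin D → ℤ), S j κ' (u + (N : ℤ) • t) = shiftK (-((N : ℤ) • t)) (S j κ' u))
    (κ' : Fin D) (u t : Fin D → ℤ) : Sinf κ' (u + (N : ℤ) • t) = shiftK (-((N : ℤ) • t)) (Sinf κ' u) := by
  funext x z a b
  have h1 := hS κ' (u + (N : ℤ) • t) x z a b
  have h2 : Tendsto (fun j => S j κ' (u + (N : ℤ) • t) x z a b) atTop (𝓝 (shiftK (-((N : ℤ) • t)) (Sinf κ' u) x z a b)) := by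
    have e : ∀ j, S j κ' (u + (N : ℤ) • t) x z a b = S j κ' u (x + -((N : ℤ) • t)) (z + -((N : ℤ) • t)) a b := fun j => by
      rw [hSt j κ' u t]; rfl
    simp only [e]; exact hS κ' u _ _ a b
  exact tendsto_nhds_unique h1 h2

/-- [folklore] **(Wt) PASSES TO ENTRYWISE LIMITS**: `W j μ (y+t) ν (y′+t) = shiftK (−N•t) (W j μ y ν y′) ∀ j` ⟹ the same for `W∞`. -/
theorem table_translate_of_tendsto {D : ℕ} {F : Type*} {W : ℕ → Fin D → (Fin D → ℤ) → Fin D → (Fin D → ℤ) → MKer D F}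
    {Winf : Fin D → (Fin D → ℤ) → Fin D → (Fin D → ℤ) → MKer D F}
    (hW : ∀ μ y ν y' x z a b, Tendsto (fun j => W j μ y ν y' x z a b) atTop (𝓝 (Winf μ y ν y' x z a b)))
    (hWt : ∀ (j : ℕ) (μ : Fin D) (y : Fin D → ℤ) (ν : Fin D) (y' t : Fin D → ℤ),
      W j μ (y + t) ν (y' + t) = shiftK (-((N : ℤ) • t)) (W j μ y ν y'))
    (μ : Fin D) (y : Fin D → ℤ) (ν : Fin D) (y' t : Fin D → ℤ) :
    Winf μ (y + t) ν (y' + t) = shiftK (-((N : ℤ) • t)) (Winf μ y ν y') := by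
  funext x z a b
  have h1 := hW μ (y + t) ν (y' + t) x z a b
  have h2 : Tendsto (fun j => W j μ (y + t) ν (y' + t) x z a b) atTop (𝓝 (shiftK (-((N : ℤ) • t)) (Winf μ y ν y') x z a b)) := by
    have e : ∀ j, W j μ (y + t) ν (y' + t) x z a b = W j μ y ν y' (x + -((N : ℤ) • t)) (z + -((N : ℤ) • t)) a b := fun j => by
      rw [hWt j μ y ν y' t]; rfl
    simp only [e]; exact hW μ y ν y' _ _ a b
  exact tendsto_nhds_unique h1 h2

/-- [folklore] **COMMUTATION WITH A FIXED LETTER PASSES TO THE LIMIT** in the `Decays`-rate currency: `comp E (X j) = comp (X j) E ∀ j`,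
`X j → X∞` at a geometric `Decays`-rate with uniform bounds ⟹ `comp E X∞ = comp X∞ E`. -/
theorem comm_of_rate {D : ℕ} {F : Type*} [Fintype F] {X : ℕ → MKer D F} {Xinf E : MKer D F} {CX CE cX δ θ : ℝ}
    (hcomm : ∀ j, comp E (X j) = comp (X j) E) (hX : ∀ j, Decays (X j) CX δ) (hXinf : Decays Xinf CX δ) (hE : Decays E CE δ)
    (hXr : ∀ j, Decays (X j - Xinf) (cX * θ ^ j) δ) (hδ : 0 < δ) (hθ0 : 0 ≤ θ) (hθ1 : θ < 1) :
    comp E Xinf = comp Xinf E := by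
  have hEr : ∀ j : ℕ, Decays ((fun _ : ℕ => E) j - E) (0 * θ ^ j) δ := decays_rate_const E δ θ
  have h1 : ∀ x y a b, Tendsto (fun j => comp E (X j) x y a b) atTop (𝓝 (comp E Xinf x y a b)) :=
    tendsto_comp_of_rate (A := fun _ => E) (fun _ => hE) hXinf hEr hXr hδ hθ0 hθ1
  have h2 : ∀ x y a b, Tendsto (fun j => comp (X j) E x y a b) atTop (𝓝 (comp Xinf E x y a b)) :=
    tendsto_comp_of_rate (B := fun _ => E) hX hE hXr hEr hδ hθ0 hθ1
  exact eq_of_tendsto_of_eq (K := fun j => comp E (X j)) (L := fun j => comp (X j) E) hcomm h1 h2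

end H
/-! ## §2 an1's COARSE Ward END for an ARBITRARY triple `(K, S, W)` of the generic shape `hessKer K (vertexOfK K N S) W` -/
section Letters
/-- [folklore] **THE COARSE WARD END FROM THE FOUR COARSE LETTERS, GENERIC TRIPLE.**  For ANY decaying, block-translation invariant `K`, ANY
localised block-covariant stencil family `S` and table family `W` (raw families; the `JetData` record is assembled here), the four coarse
letters (K) `RelInv K 𝕄 E`, (H) the ℋ-column Ward law with constant `c_H`, (S) the block-stencil Ward law with generator `X`, (W) the (W2♮) law
with generators `X`, `X₂` and a tadpole-null remainder `Nr` give `WardTransversal (flipK (hessKer K (vertexOfK K N S) W))` —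
`KernelWardRelative.wardTransversal_flipK_hessKer_conj_rel` BY NAME.  No perfect object, no dressing is named: road FP instantiates at its triple. -/
theorem wardTransversal_flipK_hessKer_vertexOfK_of_letters {K M E : MKer (d + 1) (Fib d)} {CK δK : ℝ} (hKd : Decays K CK δK)
    (hδK : 0 < δK) (hKs : ∀ t : Fin (d + 1) → ℤ, shiftK (-((N : ℤ) • t)) K = K) (hN : 1 ≤ N) (hM : Spr M) (hE : Spr E)
    (hR : RelInv K M E)
    {S : Fin (d + 1) → (Fin (d + 1) → ℤ) → MKer (d + 1) (Fib d)}
    {W : Fin (d + 1) → (Fin (d + 1) → ℤ) → Fin (d + 1) → (Fin (d + 1) → ℤ) → MKer (d + 1) (Fib d)} {Cs Cw δ : ℝ} (hδ : 0 < δ)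
    (hSl : LocStencil S Cs δ) (hWl : VertexFamily₂ W N Cw δ)
    (hSt : ∀ (κ' : Fin (d + 1)) (u t : Fin (d + 1) → ℤ), S κ' (u + (N : ℤ) • t) = shiftK (-((N : ℤ) • t)) (S κ' u))
    (hWt : ∀ (μ : Fin (d + 1)) (y : Fin (d + 1) → ℤ) (ν : Fin (d + 1)) (y' t : Fin (d + 1) → ℤ),
      W μ (y + t) ν (y' + t) = shiftK (-((N : ℤ) • t)) (W μ y ν y'))
    (cH : ℝ) (hH : ∀ (y : Fin (d + 1) → ℤ) (κ' : Fin (d + 1)) (u : Fin (d + 1) → ℤ),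
      ∑ μ, (colH K N μ (y - unitVec μ) κ' u - colH K N μ y κ' u) = cH * gaugeWt N y κ' u)
    (X : (Fin (d + 1) → ℤ) → MKer (d + 1) (Fib d)) (hX : ∀ y, Loc (X y)) (hEX : ∀ y, comp E (X y) = comp (X y) E)
    (X₂ Nr : (Fin (d + 1) → ℤ) → Fin (d + 1) → (Fin (d + 1) → ℤ) → MKer (d + 1) (Fib d)) (hX₂ : ∀ y ν y', Loc (X₂ y ν y'))
    (hNr : ∀ y ν y', Loc (Nr y ν y')) (hEX₂ : ∀ y ν y', comp E (X₂ y ν y') = comp (X₂ y ν y') E)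
    (hSd : ∀ y : Fin (d + 1) → ℤ, cH • ∑ v ∈ box (d + 1) N, divV S ((N : ℤ) • y + toSite v) = conjV M (X y))
    (hWd : ∀ (y : Fin (d + 1) → ℤ) (ν : Fin (d + 1)) (y' : Fin (d + 1) → ℤ),
      divW W y ν y' = conjW M 0 (vertexOfK K N S ν y') (X y) 0 (X₂ y ν y') + Nr y ν y')
    (hN0 : ∀ y ν y', tadpole K (Nr y ν y') = 0) :
    WardTransversal (flipK (hessKer K (vertexOfK K N S) W)) := by
  let J : JetData d N :=
    { S := S, W := W, Cs := Cs, Cw := Cw, δ := δ, δ_pos := hδ, loc := hSl, loc₂ := hWl }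
  exact wardTransversal_flipK_hessKer_conj_rel (N := N) ⟨δK, CK, hδK, hKd.nonneg (Sum.inl 0), hKd⟩ hKs hN hM hE hR J hSt hWt cH hH
    X hX hEX X₂ Nr hX₂ hNr hEX₂ hSd hWd hN0

end Letters
/-! ## §3 The END at a LIMIT triple, the four letters INHERITED from finite `j` -/
section Adapters
/-- [folklore] `l1 0 = 0` in the exponent: a kernel bi-localised at a DIAGONAL pair `(p, p)` decays with constant `|C|`. -/
theorem decays_of_biLoc_diag {D : ℕ} {F : Type*} {K : MKer D F} {p : Fin D → ℤ} {C δ : ℝ} (h : BiLoc K p p C δ) (hδ : 0 ≤ δ) :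
    Decays K |C| δ := by
  have h1 := decays_of_biLoc' h hδ
  simpa only [sub_self, LimitRate.l1_zero, mul_zero, Real.exp_zero, mul_one] using h1

/-- [folklore] Rate form: `BiLoc (T j − T∞) p p (c·θ^j) δ` (`0 ≤ θ`) ⟹ `Decays (T j − T∞) (|c|·θ^j) δ`. -/
theorem decays_rate_of_biLoc_diag {D : ℕ} {F : Type*} {T : ℕ → MKer D F} {Tinf : MKer D F} {p : Fin D → ℤ} {c δ θ : ℝ}
    (h : ∀ j, BiLoc (T j - Tinf) p p (c * θ ^ j) δ) (hδ : 0 ≤ δ) (hθ0 : 0 ≤ θ) (j : ℕ) :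
    Decays (T j - Tinf) (|c| * θ ^ j) δ := by
  have h1 := decays_of_biLoc_diag (h j) hδ
  rwa [abs_mul, abs_pow, abs_of_nonneg hθ0] at h1

/-- [folklore] A general bi-localised letter decays: constant `|C|·e^{δ|p−q|₁}` (`LetterInheritance.decays_of_biLoc'`), rate form. -/
theorem decays_rate_of_biLoc {D : ℕ} {F : Type*} {T : ℕ → MKer D F} {Tinf : MKer D F} {p q : Fin D → ℤ} {c δ θ : ℝ}
    (h : ∀ j, BiLoc (T j - Tinf) p q (c * θ ^ j) δ) (hδ : 0 ≤ δ) (hθ0 : 0 ≤ θ) (j : ℕ) :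
    Decays (T j - Tinf) (|c| * Real.exp (δ * l1 (p - q)) * θ ^ j) δ := by
  have h1 := decays_of_biLoc' (h j) hδ
  rw [abs_mul, abs_pow, abs_of_nonneg hθ0] at h1
  intro x y a b
  refine (h1 x y a b).trans (le_of_eq ?_)
  ring

/-- [folklore] The chain-rule vertex of a decaying `K` and a local `S`, read at ONE coarse bond `(ν, y′)`, decays (rate `δ/2`, constant
`|(d+1)·(C·Cs·Zl(δ/2))|`). -/
theorem decays_vertexOfK_apply {K : MKer (d + 1) (Fib d)} {C δK : ℝ} (hK : Decays K C δK)
    {S : Fin (d + 1) → (Fin (d + 1) → ℤ) → MKer (d + 1) (Fib d)} {Cs δ : ℝ} (hS : LocStencil S Cs δ) (hδ : 0 < δ) (hδK : δ ≤ δK)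
    (ν : Fin (d + 1)) (y' : Fin (d + 1) → ℤ) :
    Decays (vertexOfK K N S ν y') |((d + 1 : ℕ) * (C * Cs * Zl (d + 1) (δ / 2)))| (δ / 2) := by
  have h := vertexFamily_vertexOfK_uniform (K := fun _ : ℕ => K) (S := fun _ : ℕ => S) (fun _ => hK) (fun _ => hS) hδ hδK N 0 ν y'
  exact decays_of_biLoc_diag h (by linarith)

/-- [folklore] RATE FORM for the chain-rule vertex at ONE coarse bond: `Decays (vertexOfK (K j) N (S j) ν y′ − vertexOfK K∞ N S∞ ν y′)
(|c′|·θ^j) (δ/2)` with `c′ := (d+1)·((cK·Cs + C·cS)·Zl(δ/2))` (`HessKerRate.vertexFamily_vertexOfK_rate`). -/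
theorem decays_vertexOfK_rate_apply {K : ℕ → MKer (d + 1) (Fib d)} {Kinf : MKer (d + 1) (Fib d)}
    {S : ℕ → Fin (d + 1) → (Fin (d + 1) → ℤ) → MKer (d + 1) (Fib d)} {Sinf : Fin (d + 1) → (Fin (d + 1) → ℤ) → MKer (d + 1) (Fib d)}
    {C cK δK Cs cS δ θ : ℝ} (hK : ∀ j, Decays (K j) C δK) (hKinf : Decays Kinf C δK)
    (hKr : ∀ j, Decays (K j - Kinf) (cK * θ ^ j) δK) (hS : ∀ j, LocStencil (S j) Cs δ) (hSinf : LocStencil Sinf Cs δ)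
    (hSr : ∀ j, LocStencil (S j - Sinf) (cS * θ ^ j) δ) (hδ : 0 < δ) (hδK : δ ≤ δK) (hθ0 : 0 ≤ θ)
    (ν : Fin (d + 1)) (y' : Fin (d + 1) → ℤ) (j : ℕ) :
    Decays (vertexOfK (K j) N (S j) ν y' - vertexOfK Kinf N Sinf ν y')
      (|((d + 1 : ℕ) * ((cK * Cs + C * cS) * Zl (d + 1) (δ / 2)))| * θ ^ j) (δ / 2) := by
  have h := fun k => vertexFamily_vertexOfK_rate hK hKinf hKr hS hSinf hSr hδ hδK N k ν y'
  have h' : ∀ k, BiLoc ((fun k => vertexOfK (K k) N (S k) ν y') k - vertexOfK Kinf N Sinf ν y') ((N : ℤ) • y') ((N : ℤ) • y')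
      (((d + 1 : ℕ) * ((cK * Cs + C * cS) * Zl (d + 1) (δ / 2))) * θ ^ k) (δ / 2) := fun k => by
    simpa only [Pi.sub_apply] using h k
  exact decays_rate_of_biLoc_diag h' (by linarith) hθ0 j

/-- [folklore] Entrywise convergence of a stencil family from `LocStencil`-rate data. -/
theorem tendsto_stencil_of_rate {S : ℕ → Fin (d + 1) → (Fin (d + 1) → ℤ) → MKer (d + 1) (Fib d)}
    {Sinf : Fin (d + 1) → (Fin (d + 1) → ℤ) → MKer (d + 1) (Fib d)} {cS δ θ : ℝ}
    (hSr : ∀ j, LocStencil (S j - Sinf) (cS * θ ^ j) δ) (hθ0 : 0 ≤ θ) (hθ1 : θ < 1)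
    (κ : Fin (d + 1)) (u x z : Fin (d + 1) → ℤ) (a b : Fib d) :
    Tendsto (fun j => S j κ u x z a b) atTop (𝓝 (Sinf κ u x z a b)) :=
  tendsto_of_biLoc_rate (T := fun j => S j κ u) (fun k => by simpa only [Pi.sub_apply] using hSr k κ u) hθ0 hθ1 x z a b

/-- [folklore] Entrywise convergence of a table family from `VertexFamily₂`-rate data. -/
theorem tendsto_table_of_rate {W : ℕ → Fin (d + 1) → (Fin (d + 1) → ℤ) → Fin (d + 1) → (Fin (d + 1) → ℤ) → MKer (d + 1) (Fib d)}
    {Winf : Fin (d + 1) → (Fin (d + 1) → ℤ) → Fin (d + 1) → (Fin (d + 1) → ℤ) → MKer (d + 1) (Fib d)} {cW δ θ : ℝ}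
    (hWr : ∀ j, VertexFamily₂ (W j - Winf) N (cW * θ ^ j) δ) (hθ0 : 0 ≤ θ) (hθ1 : θ < 1)
    (μ : Fin (d + 1)) (y : Fin (d + 1) → ℤ) (ν : Fin (d + 1)) (y' x z : Fin (d + 1) → ℤ) (a b : Fib d) :
    Tendsto (fun j => W j μ y ν y' x z a b) atTop (𝓝 (Winf μ y ν y' x z a b)) :=
  tendsto_of_biLoc_rate (T := fun j => W j μ y ν y') (fun k => by simpa only [Pi.sub_apply] using hWr k μ y ν y') hθ0 hθ1 x z a b

/-- [folklore] Entrywise convergence of the coarse divergence `divW (W j) y ν y′` (a finite sum of table members). -/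
theorem tendsto_divW_of_rate {W : ℕ → Fin (d + 1) → (Fin (d + 1) → ℤ) → Fin (d + 1) → (Fin (d + 1) → ℤ) → MKer (d + 1) (Fib d)}
    {Winf : Fin (d + 1) → (Fin (d + 1) → ℤ) → Fin (d + 1) → (Fin (d + 1) → ℤ) → MKer (d + 1) (Fib d)} {cW δ θ : ℝ}
    (hWr : ∀ j, VertexFamily₂ (W j - Winf) N (cW * θ ^ j) δ) (hθ0 : 0 ≤ θ) (hθ1 : θ < 1)
    (y : Fin (d + 1) → ℤ) (ν : Fin (d + 1)) (y' x z : Fin (d + 1) → ℤ) (a b : Fib d) :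
    Tendsto (fun j => divW (W j) y ν y' x z a b) atTop (𝓝 (divW Winf y ν y' x z a b)) := by
  simp only [divW, Finset.sum_apply, Pi.sub_apply]
  exact tendsto_finsetSum _ fun μ _ =>
    (tendsto_table_of_rate hWr hθ0 hθ1 μ _ ν y' x z a b).sub (tendsto_table_of_rate hWr hθ0 hθ1 μ y ν y' x z a b)

end Adapters
section End
/-- [folklore] **THE COARSE WARD END AT A LIMIT TRIPLE, THE FOUR LETTERS INHERITED FROM FINITE `j`.**  Data: ANY family
`(K j, 𝕄 j, E, S j, W j, X j, X₂ j, N j, c_H j)` with a limit triple `(K∞, S∞, W∞)` and limit letters' data `(𝕄∞, X∞, X₂∞, N∞, c_H∞)`;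
uniform bounds and geometric rates in the cell's currencies (`Decays` for `K`, `𝕄`; `LocStencil` for `S`; `VertexFamily₂` for `W`; `BiLoc` at
fixed points for `X`, `X₂`, `N`; `c_H j → c_H∞`; one rate `δ > 0`, `0 ≤ θ < 1`); the block covariances of the limit triple; and AT EVERY `j`
the four coarse letters (K) `RelInv (K j) (𝕄 j) E`, (H), (S), (W) + the commutations `[E, X j y] = 0 = [E, X₂ j y ν y′]`.  THEN
`WardTransversal (flipK (hessKer K∞ (vertexOfK K∞ N S∞) W∞))`.  Letters inherited by `FP/LetterInheritance` ((K) `relInv_of_rate`, (S)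
`blockWard_of_rate`, (W) `law_conjW_of_rate` + `tadpoleNull_of_rate`) and §1 `hH_of_tendsto` ((H)); END = §2. -/
theorem wardTransversal_flipK_hessKer_vertexOfK_of_inherited_letters
    {K M : ℕ → MKer (d + 1) (Fib d)} {Kinf Minf E : MKer (d + 1) (Fib d)}
    {S : ℕ → Fin (d + 1) → (Fin (d + 1) → ℤ) → MKer (d + 1) (Fib d)} {Sinf : Fin (d + 1) → (Fin (d + 1) → ℤ) → MKer (d + 1) (Fib d)}
    {W : ℕ → Fin (d + 1) → (Fin (d + 1) → ℤ) → Fin (d + 1) → (Fin (d + 1) → ℤ) → MKer (d + 1) (Fib d)}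
    {Winf : Fin (d + 1) → (Fin (d + 1) → ℤ) → Fin (d + 1) → (Fin (d + 1) → ℤ) → MKer (d + 1) (Fib d)}
    {X : ℕ → (Fin (d + 1) → ℤ) → MKer (d + 1) (Fib d)} {Xinf : (Fin (d + 1) → ℤ) → MKer (d + 1) (Fib d)}
    {X₂ Nr : ℕ → (Fin (d + 1) → ℤ) → Fin (d + 1) → (Fin (d + 1) → ℤ) → MKer (d + 1) (Fib d)}
    {X₂inf Nrinf : (Fin (d + 1) → ℤ) → Fin (d + 1) → (Fin (d + 1) → ℤ) → MKer (d + 1) (Fib d)}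
    {cH : ℕ → ℝ} {cHinf : ℝ} {CK CM CE Cs Cw CX CX₂ CN cK cM cS cW cX cX₂ cN δ θ : ℝ}
    {pX qX : (Fin (d + 1) → ℤ) → (Fin (d + 1) → ℤ)}
    {pX₂ qX₂ pN qN : (Fin (d + 1) → ℤ) → Fin (d + 1) → (Fin (d + 1) → ℤ) → (Fin (d + 1) → ℤ)}
    (hδ : 0 < δ) (hθ0 : 0 ≤ θ) (hθ1 : θ < 1) (hN : 1 ≤ N)
    -- uniform bounds and limits' bounds
    (hK : ∀ j, Decays (K j) CK δ) (hKinf : Decays Kinf CK δ) (hM : ∀ j, Decays (M j) CM δ) (hMinf : Decays Minf CM δ)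
    (hE : Decays E CE δ) (hS : ∀ j, LocStencil (S j) Cs δ) (hSinf : LocStencil Sinf Cs δ)
    (hWinf : VertexFamily₂ Winf N Cw δ)
    (hX : ∀ j y, BiLoc (X j y) (pX y) (qX y) CX δ) (hXinf : ∀ y, BiLoc (Xinf y) (pX y) (qX y) CX δ)
    (hX₂ : ∀ j y ν y', BiLoc (X₂ j y ν y') (pX₂ y ν y') (qX₂ y ν y') CX₂ δ)
    (hX₂inf : ∀ y ν y', BiLoc (X₂inf y ν y') (pX₂ y ν y') (qX₂ y ν y') CX₂ δ)
    (hNr : ∀ j y ν y', BiLoc (Nr j y ν y') (pN y ν y') (qN y ν y') CN δ)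
    (hNrinf : ∀ y ν y', BiLoc (Nrinf y ν y') (pN y ν y') (qN y ν y') CN δ)
    -- rates
    (hKr : ∀ j, Decays (K j - Kinf) (cK * θ ^ j) δ) (hMr : ∀ j, Decays (M j - Minf) (cM * θ ^ j) δ)
    (hSr : ∀ j, LocStencil (S j - Sinf) (cS * θ ^ j) δ) (hWr : ∀ j, VertexFamily₂ (W j - Winf) N (cW * θ ^ j) δ)
    (hXr : ∀ j y, BiLoc (X j y - Xinf y) (pX y) (qX y) (cX * θ ^ j) δ)
    (hX₂r : ∀ j y ν y', BiLoc (X₂ j y ν y' - X₂inf y ν y') (pX₂ y ν y') (qX₂ y ν y') (cX₂ * θ ^ j) δ)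
    (hNrr : ∀ j y ν y', BiLoc (Nr j y ν y' - Nrinf y ν y') (pN y ν y') (qN y ν y') (cN * θ ^ j) δ)
    (hcH : Tendsto cH atTop (𝓝 cHinf))
    -- block covariances of the limit triple
    (hKs : ∀ t : Fin (d + 1) → ℤ, shiftK (-((N : ℤ) • t)) Kinf = Kinf)
    (hSt : ∀ (κ' : Fin (d + 1)) (u t : Fin (d + 1) → ℤ), Sinf κ' (u + (N : ℤ) • t) = shiftK (-((N : ℤ) • t)) (Sinf κ' u))
    (hWt : ∀ (μ : Fin (d + 1)) (y : Fin (d + 1) → ℤ) (ν : Fin (d + 1)) (y' t : Fin (d + 1) → ℤ),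
      Winf μ (y + t) ν (y' + t) = shiftK (-((N : ℤ) • t)) (Winf μ y ν y'))
    -- the four coarse letters and the commutations AT EVERY `j`
    (hR : ∀ j, RelInv (K j) (M j) E)
    (hH : ∀ (j : ℕ) (y : Fin (d + 1) → ℤ) (κ' : Fin (d + 1)) (u : Fin (d + 1) → ℤ),
      ∑ μ, (colH (K j) N μ (y - unitVec μ) κ' u - colH (K j) N μ y κ' u) = cH j * gaugeWt N y κ' u)
    (hEX : ∀ j y, comp E (X j y) = comp (X j y) E) (hEX₂ : ∀ j y ν y', comp E (X₂ j y ν y') = comp (X₂ j y ν y') E)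
    (hSd : ∀ (j : ℕ) (y : Fin (d + 1) → ℤ),
      cH j • ∑ v ∈ box (d + 1) N, divV (S j) ((N : ℤ) • y + toSite v) = conjV (M j) (X j y))
    (hWd : ∀ (j : ℕ) (y : Fin (d + 1) → ℤ) (ν : Fin (d + 1)) (y' : Fin (d + 1) → ℤ),
      divW (W j) y ν y' = conjW (M j) 0 (vertexOfK (K j) N (S j) ν y') (X j y) 0 (X₂ j y ν y') + Nr j y ν y')
    (hN0 : ∀ j y ν y', tadpole (K j) (Nr j y ν y') = 0) :
    WardTransversal (flipK (hessKer Kinf (vertexOfK Kinf N Sinf) Winf)) := by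
  obtain ⟨hδ2, hδ2le⟩ : 0 < δ / 2 ∧ δ / 2 ≤ δ := ⟨by linarith, by linarith⟩
  -- entrywise convergences
  have tK : ∀ x z a b, Tendsto (fun j => K j x z a b) atTop (𝓝 (Kinf x z a b)) := tendsto_of_decays_rate hKr hθ0 hθ1
  have tS : ∀ κ u x z a b, Tendsto (fun j => S j κ u x z a b) atTop (𝓝 (Sinf κ u x z a b)) := tendsto_stencil_of_rate hSr hθ0 hθ1
  -- (K)
  have hRinf : RelInv Kinf Minf E := relInv_of_rate hR hK hM hE hKinf hMinf hKr hMr hδ hθ0 hθ1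
  -- (H)
  have hHinf := hH_of_tendsto (N := N) tK hcH hH
  -- `X`, `X₂`, `N` in the `Decays` currency (per coarse index)
  have dX : ∀ j y, Decays (X j y) (|CX| * Real.exp (δ * l1 (pX y - qX y))) δ := fun j y => decays_of_biLoc' (hX j y) hδ.le
  have dXinf : ∀ y, Decays (Xinf y) (|CX| * Real.exp (δ * l1 (pX y - qX y))) δ := fun y => decays_of_biLoc' (hXinf y) hδ.le
  have dXr : ∀ y j, Decays (X j y - Xinf y) (|cX| * Real.exp (δ * l1 (pX y - qX y)) * θ ^ j) δ := fun y j =>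
    decays_rate_of_biLoc (T := fun j => X j y) (fun k => hXr k y) hδ.le hθ0 j
  have dX₂ : ∀ j y ν y', Decays (X₂ j y ν y') (|CX₂| * Real.exp (δ * l1 (pX₂ y ν y' - qX₂ y ν y'))) δ := fun j y ν y' =>
    decays_of_biLoc' (hX₂ j y ν y') hδ.le
  have dX₂inf : ∀ y ν y', Decays (X₂inf y ν y') (|CX₂| * Real.exp (δ * l1 (pX₂ y ν y' - qX₂ y ν y'))) δ := fun y ν y' =>
    decays_of_biLoc' (hX₂inf y ν y') hδ.le
  have dX₂r : ∀ y ν y' j, Decays (X₂ j y ν y' - X₂inf y ν y') (|cX₂| * Real.exp (δ * l1 (pX₂ y ν y' - qX₂ y ν y')) * θ ^ j) δ :=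
    fun y ν y' j => decays_rate_of_biLoc (T := fun j => X₂ j y ν y') (fun k => hX₂r k y ν y') hδ.le hθ0 j
  -- commutations at the limit
  have hEXinf : ∀ y, comp E (Xinf y) = comp (Xinf y) E := fun y =>
    comm_of_rate (X := fun j => X j y) (fun j => hEX j y) (fun j => dX j y) (dXinf y) hE (dXr y) hδ hθ0 hθ1
  have hEX₂inf : ∀ y ν y', comp E (X₂inf y ν y') = comp (X₂inf y ν y') E := fun y ν y' =>
    comm_of_rate (X := fun j => X₂ j y ν y') (fun j => hEX₂ j y ν y') (fun j => dX₂ j y ν y') (dX₂inf y ν y') hE (dX₂r y ν y')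
      hδ hθ0 hθ1
  -- (S)
  have hSdinf : ∀ y : Fin (d + 1) → ℤ,
      cHinf • ∑ v ∈ box (d + 1) N, divV Sinf ((N : ℤ) • y + toSite v) = conjV Minf (Xinf y) := fun y =>
    blockWard_of_rate (M := M) (X := fun j => X j y) (box (d + 1) N) (fun v => (N : ℤ) • y + toSite v) (fun j => hSd j y) tS hcH
      hM (fun j => dX j y) hMinf (dXinf y) hMr (dXr y) hδ hθ0 hθ1
  -- (W): the six contact letters at the common rate `δ/2`
  have hM2 : ∀ j, Decays (M j) CM (δ / 2) := fun j => DecayingKernelNeumann.decays_of_le (hM j) hδ2le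
  have hMinf2 : Decays Minf CM (δ / 2) := DecayingKernelNeumann.decays_of_le hMinf hδ2le
  have hMr2 : ∀ j, Decays (M j - Minf) (|cM| * θ ^ j) (δ / 2) := decays_rate_of_le hMr hθ0 hδ2le
  have hV0 : ∀ _ : ℕ, Decays (0 : MKer (d + 1) (Fib d)) 0 (δ / 2) := fun _ => decays_zero _
  have hV0r : ∀ j : ℕ, Decays ((fun _ : ℕ => (0 : MKer (d + 1) (Fib d))) j - 0) (0 * θ ^ j) (δ / 2) := decays_rate_const 0 _ θ
  have hVp : ∀ ν y' j, Decays (vertexOfK (K j) N (S j) ν y') |((d + 1 : ℕ) * (CK * Cs * Zl (d + 1) (δ / 2)))| (δ / 2) :=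
    fun ν y' j => decays_vertexOfK_apply (hK j) (hS j) hδ le_rfl ν y'
  have hVpinf : ∀ ν y', Decays (vertexOfK Kinf N Sinf ν y') |((d + 1 : ℕ) * (CK * Cs * Zl (d + 1) (δ / 2)))| (δ / 2) :=
    fun ν y' => decays_vertexOfK_apply hKinf hSinf hδ le_rfl ν y'
  have hVpr : ∀ ν y' j, Decays (vertexOfK (K j) N (S j) ν y' - vertexOfK Kinf N Sinf ν y')
      (|((d + 1 : ℕ) * ((cK * Cs + CK * cS) * Zl (d + 1) (δ / 2)))| * θ ^ j) (δ / 2) :=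
    fun ν y' j => decays_vertexOfK_rate_apply hK hKinf hKr hS hSinf hSr hδ le_rfl hθ0 ν y' j
  have hX2 : ∀ y j, Decays (X j y) (|CX| * Real.exp (δ * l1 (pX y - qX y))) (δ / 2) := fun y j =>
    DecayingKernelNeumann.decays_of_le (dX j y) hδ2le
  have hXinf2 : ∀ y, Decays (Xinf y) (|CX| * Real.exp (δ * l1 (pX y - qX y))) (δ / 2) := fun y =>
    DecayingKernelNeumann.decays_of_le (dXinf y) hδ2le
  have hXr2 : ∀ y j, Decays (X j y - Xinf y) (|(|cX| * Real.exp (δ * l1 (pX y - qX y)))| * θ ^ j) (δ / 2) := fun y =>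
    decays_rate_of_le (A := fun j => X j y) (dXr y) hθ0 hδ2le
  have hX₂2 : ∀ y ν y' j, Decays (X₂ j y ν y') (|CX₂| * Real.exp (δ * l1 (pX₂ y ν y' - qX₂ y ν y'))) (δ / 2) := fun y ν y' j =>
    DecayingKernelNeumann.decays_of_le (dX₂ j y ν y') hδ2le
  have hX₂inf2 : ∀ y ν y', Decays (X₂inf y ν y') (|CX₂| * Real.exp (δ * l1 (pX₂ y ν y' - qX₂ y ν y'))) (δ / 2) := fun y ν y' =>
    DecayingKernelNeumann.decays_of_le (dX₂inf y ν y') hδ2le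
  have hX₂r2 : ∀ y ν y' j, Decays (X₂ j y ν y' - X₂inf y ν y')
      (|(|cX₂| * Real.exp (δ * l1 (pX₂ y ν y' - qX₂ y ν y')))| * θ ^ j) (δ / 2) := fun y ν y' =>
    decays_rate_of_le (A := fun j => X₂ j y ν y') (dX₂r y ν y') hθ0 hδ2le
  have tN : ∀ y ν y' x z a b, Tendsto (fun j => Nr j y ν y' x z a b) atTop (𝓝 (Nrinf y ν y' x z a b)) := fun y ν y' =>
    tendsto_of_biLoc_rate (T := fun j => Nr j y ν y') (fun k => hNrr k y ν y') hθ0 hθ1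
  have hWdinf : ∀ (y : Fin (d + 1) → ℤ) (ν : Fin (d + 1)) (y' : Fin (d + 1) → ℤ),
      divW Winf y ν y' = conjW Minf 0 (vertexOfK Kinf N Sinf ν y') (Xinf y) 0 (X₂inf y ν y') + Nrinf y ν y' := fun y ν y' =>
    law_conjW_of_rate (L := fun j => divW (W j) y ν y') (N := fun j => Nr j y ν y') (M := M) (V := fun _ => 0)
      (Vp := fun j => vertexOfK (K j) N (S j) ν y') (X := fun j => X j y) (Xp := fun _ => 0) (X₂ := fun j => X₂ j y ν y')
      (fun j => hWd j y ν y') (tendsto_divW_of_rate hWr hθ0 hθ1 y ν y') (tN y ν y')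
      hM2 hV0 (hVp ν y') (hX2 y) hV0 (hX₂2 y ν y') hMinf2 (decays_zero _) (hVpinf ν y') (hXinf2 y) (decays_zero _) (hX₂inf2 y ν y')
      hMr2 hV0r (hVpr ν y') (hXr2 y) hV0r (hX₂r2 y ν y') hδ2 hθ0 hθ1
  -- tadpole-null remainder at the limit
  have hN0inf : ∀ y ν y', tadpole Kinf (Nrinf y ν y') = 0 := fun y ν y' =>
    tadpoleNull_of_rate (A := K) (N := fun j => Nr j y ν y') (fun j => hN0 j y ν y') hK hKinf (fun j => hNr j y ν y') (hNrinf y ν y')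
      hKr (fun j => hNrr j y ν y') hδ hθ0 hθ1
  -- localisation of the limit letters
  have hXl : ∀ y, Loc (Xinf y) := fun y => ⟨_, _, _, _, hδ, hXinf y⟩
  have hX₂l : ∀ y ν y', Loc (X₂inf y ν y') := fun y ν y' => ⟨_, _, _, _, hδ, hX₂inf y ν y'⟩
  have hNl : ∀ y ν y', Loc (Nrinf y ν y') := fun y ν y' => ⟨_, _, _, _, hδ, hNrinf y ν y'⟩
  -- END
  exact wardTransversal_flipK_hessKer_vertexOfK_of_letters hKinf hδ hKs hN ⟨CM, δ, hδ, hMinf⟩ ⟨CE, δ, hδ, hE⟩ hRinf hδ hSinf hWinf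
    hSt hWt cHinf hHinf Xinf hXl hEXinf X₂inf Nrinf hX₂l hNl hEX₂inf hSdinf hWdinf hN0inf
end End
end Summit.QuantumFields.BalabanUV.Beta.FP.LetterInheritanceEnd
end
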